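import Summits.QuantumFields.YangMills.Theorems.AlphaInputsT3ACv3XsSelectionOfSizes
import Summits.QuantumFields.YangMills.Theorems.AlphaInputsT3ACv3ProfileLargeRec
import HarnessLib

/-!
# `AlphaInputsT3ACv3XsSelectionClosed` — THE Sel∕Xs SELECTION HALF IS UNCONDITIONAL AT THE RECORD SIZES: ✓ `exists_inClassSelT3Xs_of_sizes_of_profRec` (this seat) with its one
# displayed kinematic row (U2) DISCHARGED by ★w4-19936 g5's ✓ `AlphaInputsT3AC.profRec_of_collar` (`…v3ProfileLargeRec`: the enlarged-region profile is (67)-large in RECORDING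
# currency) — cell `ym3-torus`, crux stmt-QuantumFields-19936 (`HistoryTailL`, line v5p10), width seat ym-ust-19936-w5 (g4), closer (o1)

WHAT.  ★★★ `AlphaInputsT3AC.exists_inClassSelT3Xs_of_sizes` — for a measurable trivial-history family `Ut`: the record's size rows (`hA3`, `hA2`, `1 ≤ 2B₃`, `4B₃L²·awf ≤ C68`, `hCe`, `hCa`),
the collar `7L + 3 ≤ M₁` and the `B₃`-floor `max (max (10²⁷+1) 257·L²) (avgWindowFactor L ∕ (24·(1∕(10³⁴·L)))) ≤ B₃` ⟹ `∃ UkH, InClassSelT3Xs F 𝔠 γ hγ hγ1 K Ut UkH ∧` (argmin of the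
Wilson action over `𝒞_Xs(k, h, W)` at every admissible non-trivial `(k, h, W)`), NO kinematic hypothesis; ★★★ `…_of_trivMinimiserRows_of_sizes` — the same from (D5) in the binder shape
of `DataRowsT3XsChiSel` (`∃ UkH (hU0), InClassSelT3Xs … ∧ argmin`).  So LEAD ★w1-19936 g4's (L1) door knit can display, per family and `(γ, K)`, ONLY «∃ 𝔖 𝔄, NODE O's three data
conjuncts for the selected map» beyond T8 and the sizes.  Chain by name: selector ✓p623120 → free-seam glue in one currency ✓p623726 → (EL) at sizes + assembly ✓p625877 → (U2)
✓ `profRec_of_collar` (★w4 g5) → this file.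
HONEST FRAMING.  Assembly only; the argmin is NOT claimed to be print's (42)-minimiser (its interiority and NODE O's rows 22–23 for it are B0–B4's business); the stub 2′χ, the crux
`HistoryTailL`, T8 and any gap are NOT claimed.  Count-neutral helper (`--supports stmt-QuantumFields-19936`); registry untouched.  YM₃ on the three-torus is rung R3 of the programme,
NOT the Clay problem (no bearing on d = 4, infinite volume, or a mass gap).

References: T. Bałaban, Commun. Math. Phys. 102 (1985) 255–275 [Balaban1985UV3] ((40)–(42) p.266, (67)–(68) p.273); Commun. Math. Phys. 102 (1985) 277–309
[Balaban1985Variational] (Thm 1 (8) p.279, (11)–(15) pp.279–280).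
-/

set_option autoImplicit false

noncomputable section

namespace Summit.QuantumFields.YangMills.Theorems

open MeasureTheory Set
open scoped Matrix Matrix.Norms.L2Operator
open Literature.MathematicalPhysics.QuantumFieldTheory.Balaban1983to89
open Literature.MathematicalPhysics.QuantumFieldTheory.Balaban1983to89.T3ContinuumYM3Torus
open Literature.MathematicalPhysics.QuantumFieldTheory.Balaban1983to89.ExpMeanLog (deltaSU)
open Literature.MathematicalPhysics.QuantumFieldTheory.Balaban1985CMP102.Setting
open Summit.QuantumFields.Balaban3D.Carriers
open Summit.QuantumFields.Balaban3D.Proofs.Primitives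
open Summit.QuantumFields.Balaban3D.Proofs.Thresholds (Q0 Q0_pos)

section T3

variable {F : T3Family} {𝔠 : AlphaConsts F.L (suGroupModel 2).N}

/-- ★★★ **THE Sel∕Xs SELECTION ROW, UNCONDITIONAL AT THE RECORD SIZES**: for a MEASURABLE trivial-history family `Ut`, the record's size rows, the collar `7L + 3 ≤ M₁` and the
`B₃`-floor give `∃ UkH, InClassSelT3Xs F 𝔠 γ hγ hγ1 K Ut UkH` with `UkH k h W` an argmin of the Wilson action over `𝒞_Xs(k, h, W)` at every admissible non-trivial `(k, h, W)` —
✓ `exists_inClassSelT3Xs_of_sizes_of_profRec` with (U2) by ★w4-19936 g5's ✓ `profRec_of_collar` ((N2′) ⇐ `collarE_T3_of_M₁_ge`, `4π ≤ C68` ⇐ `four_pi_le_C68_of_sizes`).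
[cite: Balaban1985UV3, (40)–(42) p.266 + (67)–(68) p.273; Balaban1985Variational, Thm 1 (8) p.279, (11)–(15) pp.279–280] -/
theorem AlphaInputsT3AC.exists_inClassSelT3Xs_of_sizes {a₁ : ℝ} (ha₁ : 0 < a₁)
    (hA3 : (143 * ((((3 + 4 : ℕ) : ℝ)) ^ 2 / 4) ^ 2) * (2 * (𝔠.B₃ * a₁)) ≤ 1 / 3)
    (hA2 : 2 * (2 * (𝔠.B₃ * a₁)) ≤ 2 * deltaSU (Fin 2) / (((3 + 4) * F.L : ℕ) : ℝ) ^ 2)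
    (hB₃ : 1 ≤ 2 * 𝔠.B₃) (hC : 4 * 𝔠.B₃ * (F.L : ℝ) ^ 2 * avgWindowFactor F.L ≤ 𝔠.C68)
    (hCe : Real.exp (𝔠.p₀ - 1) ≤ 3 * B7Prop2Explicit.C0 3 * 𝔠.C68 * (𝔠.b₀ * Q0 𝔠.p₀))
    (hCa : (𝔠.b₀ * Q0 𝔠.p₀) * (2 * (F.L : ℝ) ^ 2 * avgWindowFactor F.L) ^ 2 ≤ 3 * B7Prop2Explicit.C0 3 * 𝔠.C68 * a₁ ^ 2)
    (hM : 7 * F.L + 3 ≤ 𝔠.M₁)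
    (hBfl : max (max ((10 : ℝ) ^ 27 + 1) 257 * (F.L : ℝ) ^ 2) (avgWindowFactor F.L / (24 * (1 / (10 ^ 34 * (F.L : ℝ))))) ≤ 𝔠.B₃)
    {γ : ℝ} (hγ : 0 < γ) (hγ1 : γ ≤ (min 𝔠.gamma0 1) ^ 2) (K : ℕ)
    (Ut : (k : ℕ) → GaugeField (F.P K) k (Matrix.specialUnitaryGroup (Fin 2) ℂ) → GaugeField (F.P K) 0 (Matrix.specialUnitaryGroup (Fin 2) ℂ))
    (hUt : ∀ k, Measurable (Ut k)) :
    ∃ UkH : (k : ℕ) → Hist (F.P K) k → GaugeField (F.P K) k (Matrix.specialUnitaryGroup (Fin 2) ℂ) →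
        GaugeField (F.P K) 0 (Matrix.specialUnitaryGroup (Fin 2) ℂ),
      AlphaInputsT3AC.InClassSelT3Xs F 𝔠 γ hγ hγ1 K Ut UkH ∧
      ∀ (k : ℕ), k ≤ K → ∀ (h : Hist (F.P K) k),
        Hist.Admissible 𝔠.lane.carrier.M₁ (rcolOf (T3Scales F γ hγ (hγ1.trans (sq_min_one_le _ 𝔠.gamma0_pos)) K) 𝔠.lane.carrier) k h →
        h ≠ Hist.triv (F.P K) k → ∀ (W : GaugeField (F.P K) k (Matrix.specialUnitaryGroup (Fin 2) ℂ)),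
          UkH k h W ∈ AlphaInputsT3AC.adaptedClassT3Xs F 𝔠 γ hγ hγ1 K k h W ∧
          IsMinOn (fun U : GaugeField (F.P K) 0 (Matrix.specialUnitaryGroup (Fin 2) ℂ) => wilsonAction4 U)
            (AlphaInputsT3AC.adaptedClassT3Xs F 𝔠 γ hγ hγ1 K k h W) (UkH k h W) :=
  AlphaInputsT3AC.exists_inClassSelT3Xs_of_sizes_of_profRec (𝔠 := 𝔠) ha₁ hA3 hA2 hB₃ hC hCe hCa hM hBfl hγ hγ1 K Ut hUt
    (AlphaInputsT3AC.profRec_of_collar (hγ := hγ) (hγ1 := hγ1)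
      (AlphaInputsT3AC.collarE_T3_of_M₁_ge (hγ := hγ) (hγ1 := hγ1) hM) (AlphaInputsT3AC.four_pi_le_C68_of_sizes (F := F) hB₃ hC))

/-- ★★★ **THE SELECTION HALF OF (O‴χₛ), UNCONDITIONAL AT THE RECORD SIZES, IN THE BINDER SHAPE OF `DataRowsT3XsChiSel`**: from (D5) `TrivMinimiserRowsT3 F 𝔠 γ hγ hγ1 a₀ a₁ K Ut`,
the size rows, the collar and the `B₃`-floor: `∃ UkH (hU0 : ∀ V, UkH 0 (Hist.triv _ 0) V = V), InClassSelT3Xs F 𝔠 γ hγ hγ1 K Ut UkH ∧` argmin — the display's remaining content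
for THIS map is «∃ 𝔖 𝔄, NODE O's three data conjuncts». [cite: Balaban1985UV3, Thm 2 p.272 + (40)–(42) p.266 + (67)–(68) p.273; Balaban1985Variational, Thm 1 (8) p.279] -/
theorem AlphaInputsT3AC.exists_inClassSelT3Xs_of_trivMinimiserRows_of_sizes {a₀ a₁ : ℝ} (ha₁ : 0 < a₁)
    (hA3 : (143 * ((((3 + 4 : ℕ) : ℝ)) ^ 2 / 4) ^ 2) * (2 * (𝔠.B₃ * a₁)) ≤ 1 / 3)
    (hA2 : 2 * (2 * (𝔠.B₃ * a₁)) ≤ 2 * deltaSU (Fin 2) / (((3 + 4) * F.L : ℕ) : ℝ) ^ 2)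
    (hB₃ : 1 ≤ 2 * 𝔠.B₃) (hC : 4 * 𝔠.B₃ * (F.L : ℝ) ^ 2 * avgWindowFactor F.L ≤ 𝔠.C68)
    (hCe : Real.exp (𝔠.p₀ - 1) ≤ 3 * B7Prop2Explicit.C0 3 * 𝔠.C68 * (𝔠.b₀ * Q0 𝔠.p₀))
    (hCa : (𝔠.b₀ * Q0 𝔠.p₀) * (2 * (F.L : ℝ) ^ 2 * avgWindowFactor F.L) ^ 2 ≤ 3 * B7Prop2Explicit.C0 3 * 𝔠.C68 * a₁ ^ 2)
    (hM : 7 * F.L + 3 ≤ 𝔠.M₁)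
    (hBfl : max (max ((10 : ℝ) ^ 27 + 1) 257 * (F.L : ℝ) ^ 2) (avgWindowFactor F.L / (24 * (1 / (10 ^ 34 * (F.L : ℝ))))) ≤ 𝔠.B₃)
    {γ : ℝ} (hγ : 0 < γ) (hγ1 : γ ≤ (min 𝔠.gamma0 1) ^ 2) (K : ℕ)
    {Ut : (k : ℕ) → GaugeField (F.P K) k (Matrix.specialUnitaryGroup (Fin 2) ℂ) → GaugeField (F.P K) 0 (Matrix.specialUnitaryGroup (Fin 2) ℂ)}
    (hT : AlphaInputsT3AC.TrivMinimiserRowsT3 F 𝔠 γ hγ hγ1 a₀ a₁ K Ut) :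
    ∃ (UkH : (k : ℕ) → Hist (F.P K) k → GaugeField (F.P K) k (Matrix.specialUnitaryGroup (Fin 2) ℂ) →
        GaugeField (F.P K) 0 (Matrix.specialUnitaryGroup (Fin 2) ℂ))
      (_ : ∀ V : GaugeField (F.P K) 0 (Matrix.specialUnitaryGroup (Fin 2) ℂ), UkH 0 (Hist.triv (F.P K) 0) V = V),
      AlphaInputsT3AC.InClassSelT3Xs F 𝔠 γ hγ hγ1 K Ut UkH ∧
      ∀ (k : ℕ), k ≤ K → ∀ (h : Hist (F.P K) k),
        Hist.Admissible 𝔠.lane.carrier.M₁ (rcolOf (T3Scales F γ hγ (hγ1.trans (sq_min_one_le _ 𝔠.gamma0_pos)) K) 𝔠.lane.carrier) k h →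
        h ≠ Hist.triv (F.P K) k → ∀ (W : GaugeField (F.P K) k (Matrix.specialUnitaryGroup (Fin 2) ℂ)),
          UkH k h W ∈ AlphaInputsT3AC.adaptedClassT3Xs F 𝔠 γ hγ hγ1 K k h W ∧
          IsMinOn (fun U : GaugeField (F.P K) 0 (Matrix.specialUnitaryGroup (Fin 2) ℂ) => wilsonAction4 U)
            (AlphaInputsT3AC.adaptedClassT3Xs F 𝔠 γ hγ hγ1 K k h W) (UkH k h W) :=
  AlphaInputsT3AC.exists_inClassSelT3Xs_of_trivMinimiserRows_of_sizes_of_profRec (𝔠 := 𝔠) ha₁ hA3 hA2 hB₃ hC hCe hCa hM hBfl hγ hγ1 K hT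
    (AlphaInputsT3AC.profRec_of_collar (hγ := hγ) (hγ1 := hγ1)
      (AlphaInputsT3AC.collarE_T3_of_M₁_ge (hγ := hγ) (hγ1 := hγ1) hM) (AlphaInputsT3AC.four_pi_le_C68_of_sizes (F := F) hB₃ hC))

end T3

end Summit.QuantumFields.YangMills.Theorems

end
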